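import Literature.NumberTheory.Automorphic.ArchRankOneLimitFormula               -- ★ FILE M (B-p17): (M1) `smul_one_add_smul_chart_eq`, (M2) `two_sin_smul_integral_chart_eq_integral_sqrtKernel`, (M3) `chart_neg_eq`; brings FILE K (K0) `tendsto_integral_sqrtKernel`
import Literature.NumberTheory.Automorphic.ArchRankOneOrbitChart                 -- ★ (HB) F0P3a-p07: `exists_integral_comp_conj_diag_eq_smul_integral_chart`
import Literature.NumberTheory.Automorphic.ArchDiagonalTorus                      -- ★ `circleDiagonal`, `circleDiagonal_mem_unitaryGroupOfForm_diagonal`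
import Literature.NumberTheory.Automorphic.Shelstad1979.StableOrbitalIntegrals    -- ★ carpet: `HasOneSidedJump`
import HarnessLib

/-!
# The ONE-SIDED VALUES at the central wall of the normalised elliptic orbital integral of `U(1,1)`:
# `g(0+) = ∫_{τ>0, θ} f(z·1 + τ·N(θ))`, `g(0−) = −∫_{τ>0, θ} f(z·1 − τ·N(θ))`, jump = the integral of `f` over the nilpotent cone at `z·1`
# (Varadarajan 1989 §6.4 Lemma 21 (c), Thm 23; Rogawski 1990 §8.2 p. 119; Shelstad 1979 Lemma 4.3)

Topic `NumberTheory/Automorphic`; namespace `Literature.NumberTheory.Automorphic` (§1–§3, chart level, as ★ FILE M) and `Literature.NumberTheory.Automorphic.UnitaryGroup` (§4, group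
level, as ★ (R1G) `ArchRankOneLimitFormulaGroup`).  THEOREMS ONLY (no `def`, no instance, no notation, no axiom, no named fact, no `sorry`).  Cell `pub/hodgecm-mathlib`, line LH3
(closer stub `stub_N9`, crux H413 = `stmt-HodgeConjecture-24833`), DIRECT ROAD brick **(K0±)-U11** = the `w`-local analytic input of organ (J-H) «ORDER-0 (I₃) for the stable
families» (LH3-plan (g2) 2026-09-02T06:34:00Z; pen LH10-p02 (g3), census 06:5xZ): ★ (J0-H2) `archTorusOrbitalOneSidedLimitsTwo_holds` gives the EXISTENCE of the one-sided
limits and ★ (R1G) the DERIVATIVE limit; ★ FILE M says «NOT HERE: the one-sided values `g(0±)` ∕ jump relation (Thm 23; (K0) is the analytic input)» — this file supplies them.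

THE MATHEMATICS (`G₂ = U(1,1)`, form `diag(1,−1)`; `γ_ψ = diag(z e^{iψ}, z e^{−iψ})`, `|z| = 1`; `g(ψ) = 2 sin ψ · ∫_{s>1, θ∈(0,2π]} f(Y(ψ,s,θ)) ds dθ` the
Weyl-denominator-normalised integral of `f` over the hyperboloid chart of the class of `γ_ψ`, ★ FILE M).  For `sin ψ > 0` the linear substitution `s = 1 + τ∕(2 sin ψ)` turns
`g` into FILE K's kernel integral `K(ψ) = ∫_{τ>0,θ} f(A ψ + τV + √(τ(τ+2 sin ψ)) Wθ)` ((M2); here re-derived for BOTH directions `u = ±i`, (M2)_u, since FILE M keeps the `u = −i`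
twin private), and (K0) ★ `tendsto_integral_sqrtKernel` (`f` continuous, compactly supported) sends `ψ → 0`: `K(ψ) → ∫ f(A 0 + τV + τWθ)` with `A 0 = z·1`.  Hence
**`g(0+) = ∫_{τ>0, θ∈(0,2π]} f(z·1 + τ·diag(iz, −iz) + τ·W_i θ)`**, `W_i θ = (0, −iz e^{−iθ}; iz e^{iθ}, 0)` — the integral of `f` over the HALF-CONE `z·1 + τ·N(θ)`,
`N(θ) = iz·(1, −e^{−iθ}; e^{iθ}, −1)` nilpotent (§2); by the reflection (M3) (`g(ψ) = −g_{−i}(−ψ)`) **`g(0−) = −∫ f(z·1 − τ·N(θ))`** (the OTHER half-cone, §2); so both one-sided limits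
exist with EXPLICIT values and the jump `g(0+) − g(0−) = ∫ [f(z·1 + τN(θ)) + f(z·1 − τN(θ))] dτ dθ` is the integral of `f` over the full nilpotent cone at `z·1` — Varadarajan's
Lemma 21 (c) `U(0±) = ±½∫u(±s,0)ds` ∕ Thm 23 shape, Rao's cone integral (§3, ★ `HasOneSidedJump` currency of the Shelstad carpet).  §4 lifts this to the GROUP `U(1,1)` through the
orbit-chart identity ★ (HB) (`∫_{U(1,1)} f(h·diag(a,b)·h⁻¹) dμ = C₁ • ∫ f(b•1 + (a−b)•P)`): for every Haar `μ` ONE `C₁ > 0` with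
`2 sin ψ · ∫_{U(1,1)} f(h γ_ψ h⁻¹) dμ → C₁ • g(0±)` as `ψ → 0±`, for every continuous compactly supported `f` and every `z ∈ S¹` (no `C¹` needed at order 0).
NOT HERE (follow-ups named in the census): the transport to general weights `U(e₀,e₁)` ∕ frames `archLocal L 2 (diagonal β) w` and to the Cayley frame of `U(Φ₂)_w` (pattern ★
`exists_tendsto_deriv_two_sin_smul_orbitalIntegral_of_formCongr`); the SPLIT-side value (A0) «`|eˣ − e⁻ˣ|·Φ^A → c · cone integral`» and the product-quotient step (PROD-QUOT-H) of (J-H).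
HONEST LABEL: HC_CM is proved only modulo the 7 printed citations (2 remaining: hLiu418 = stmt-HodgeConjecture-24832, h413 = stmt-HodgeConjecture-24833) until rung 0 closes; real analysis
over Mathlib + ★ FILE K∕M∕(HB), count-neutral, pays nothing by itself.

WHAT IS PROVED.
* §1 (M2)_u `two_sin_smul_integral_chart_eq_integral_sqrtKernel_of_dir` (`u = ±i`, `sin ψ > 0`).
* §2 **`tendsto_two_sin_smul_integral_chart_nhdsGT`**, **`tendsto_two_sin_smul_integral_chart_nhdsLT`** (the two values; `f` continuous with compact support, `z ≠ 0`).
* §3 **`hasOneSidedJump_two_sin_mul_integral_chart`** (`E = ℂ`, jump = cone integral).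
* §4 (ns `…UnitaryGroup`) `tendsto_two_sin_smul_orbitalIntegral_nhdsGT_nhdsLT_of_chart_identity` (any `S ≤ GL₂(ℂ)` ⊇ circle torus carrying the orbit-chart identity) and the
  hypothesis-free **`exists_tendsto_two_sin_smul_orbitalIntegral_nhdsGT_nhdsLT`** ∕ **`exists_hasOneSidedJump_two_sin_mul_orbitalIntegral`** on `U(diag(1,−1))` via ★ (HB).

## References
* [Varadarajan1989] V. S. Varadarajan, *An Introduction to Harmonic Analysis on Semisimple Lie Groups*, Cambridge Stud. Adv. Math. 16 (1989), §6.4 Lemma 21 (c)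
  (`U(0±) = ±½ ∫ u(±s, 0) ds`), Thm 23 (the jump of `F_{f,B}` at `1`), Thm 22.
* [Rogawski1990] J. D. Rogawski, *Automorphic Representations of Unitary Groups in Three Variables*, Ann. of Math. Stud. 123 (1990), §8.2 pp. 119, 122–123 (`g(ψ) = 2 sin ψ · Φ`).
* [Shelstad1979] D. Shelstad, *Characters and inner forms of a quasi-split group over ℝ*, Compositio Math. 39 (1979), Lemma 4.3 p. 25 (`lim_{ν↓0} − lim_{ν↑0}`).
-/

set_option autoImplicit false

noncomputable section

namespace Literature.NumberTheory.Automorphic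

open _root_.MeasureTheory Set Filter _root_.Topology _root_.Complex
open scoped Real Matrix.Norms.Operator

variable {E : Type*} [NormedAddCommGroup E] [NormedSpace ℝ E]

/-! ## §1 (M2)_u: the normalised chart integral is the kernel integral, for both directions `u = ±i` -/

/-- `z e^{ψu} − z e^{−ψu} = 2 sin ψ · (zu)` for `u = ±i`. [folklore] -/
private theorem mul_exp_sub_mul_exp' (z u : ℂ) (hu : u = I ∨ u = -I) (ψ : ℝ) :
    z * cexp ((ψ : ℂ) * u) - z * cexp (-((ψ : ℂ) * u)) = 2 * Real.sin ψ * (z * u) := by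
  -- adapted from ★ FILE M `ArchRankOneLimitFormula` (private `mul_exp_sub_mul_exp`)
  rcases hu with rfl | rfl <;>
  · (try rw [mul_neg, neg_neg]); rw [← neg_mul, ← Complex.ofReal_neg, Complex.exp_mul_I, Complex.exp_mul_I]
    push_cast; simp only [Complex.cos_neg, Complex.sin_neg]; ring

/-- Change of variables `(τ, θ) ↦ (1 + τ∕(2σ), θ)` from `Ioi 0 ×ˢ Ioc 0 (2π)` onto `Ioi 1 ×ˢ Ioc 0 (2π)` (Jacobian `(2σ)⁻¹`):
`(2σ) · ∫_{s>1} G(s,θ) = ∫_{τ>0} G(1 + τ∕(2σ), θ)` (no integrability hypothesis). [folklore] -/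
private theorem smul_setIntegral_Ioi_one_eq' (σ : ℝ) (hσ : 0 < σ) (G : ℝ × ℝ → E) :
    (2 * σ) • ∫ p in Ioi (1 : ℝ) ×ˢ Ioc (0 : ℝ) (2 * π), G p =
      ∫ p in Ioi (0 : ℝ) ×ˢ Ioc (0 : ℝ) (2 * π), G (1 + p.1 / (2 * σ), p.2) := by
  -- adapted from ★ FILE M `ArchRankOneLimitFormula` (private `smul_setIntegral_Ioi_one_eq`)
  have h2σ : 0 < 2 * σ := by positivity
  set e : ℝ × ℝ →L[ℝ] ℝ × ℝ :=
    ((2 * σ)⁻¹ • ContinuousLinearMap.id ℝ ℝ).prodMap (ContinuousLinearMap.id ℝ ℝ) with he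
  set φ : ℝ × ℝ → ℝ × ℝ := fun p => (1 + p.1 / (2 * σ), p.2) with hφ
  have hφe : φ = fun p => ((1 : ℝ), (0 : ℝ)) + e p :=
    funext fun p => Prod.ext (by simp [φ, e, div_eq_inv_mul]) (by simp [φ, e])
  have hS : MeasurableSet (Ioi (0 : ℝ) ×ˢ Ioc (0 : ℝ) (2 * π)) := measurableSet_Ioi.prod measurableSet_Ioc
  have hderiv : ∀ p ∈ Ioi (0 : ℝ) ×ˢ Ioc (0 : ℝ) (2 * π),
      HasFDerivWithinAt φ e (Ioi (0 : ℝ) ×ˢ Ioc (0 : ℝ) (2 * π)) p := by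
    intro p _; rw [hφe]; exact (e.hasFDerivAt.const_add _).hasFDerivWithinAt
  have hinj : InjOn φ (Ioi (0 : ℝ) ×ˢ Ioc (0 : ℝ) (2 * π)) := by
    intro p _ q _ hpq
    simp only [φ, Prod.mk.injEq, add_right_inj] at hpq
    exact Prod.ext (by simpa [div_left_inj' h2σ.ne'] using hpq.1) hpq.2
  have himage : φ '' (Ioi (0 : ℝ) ×ˢ Ioc (0 : ℝ) (2 * π)) = Ioi (1 : ℝ) ×ˢ Ioc (0 : ℝ) (2 * π) := by
    have : φ = Prod.map (fun τ : ℝ => 1 + τ / (2 * σ)) id := by funext p; rfl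
    rw [this, Set.prodMap_image_prod, Set.image_id]
    congr 1
    ext s
    simp only [Set.mem_image, Set.mem_Ioi]
    constructor
    · rintro ⟨τ, hτ, rfl⟩
      have : 0 < τ / (2 * σ) := div_pos hτ h2σ
      linarith
    · intro hs
      exact ⟨2 * σ * (s - 1), by nlinarith, by field_simp; ring⟩
  have hdet : e.det = (2 * σ)⁻¹ := by
    simp only [e, ContinuousLinearMap.det, ContinuousLinearMap.coe_prodMap, LinearMap.det_prodMap,
      ContinuousLinearMap.toLinearMap_smul, ContinuousLinearMap.coe_id, LinearMap.det_smul,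
      LinearMap.det_id, Module.finrank_self, pow_one, mul_one]
  have key := integral_image_eq_integral_abs_det_fderiv_smul (μ := volume) hS hderiv hinj G
  rw [himage] at key
  rw [key, hdet, abs_of_pos (inv_pos.2 h2σ), integral_smul, smul_smul, mul_inv_cancel₀ h2σ.ne', one_smul]

/-- **(M2)_u — the normalised chart integral is FILE K's kernel integral, for both directions `u = ±i`** (`sin ψ > 0`):
`2 sin ψ · ∫_{s>1,θ} f(z e^{−ψu}·1 + (z e^{ψu} − z e^{−ψu})·P(s,θ)) = ∫_{τ>0,θ} f(A_u(ψ) + τ•V_u + √(τ(τ+2 sin ψ))•W_u θ)` with `A_u(ψ) = diag(z e^{ψu}, z e^{−ψu})`,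
`V_u = diag(zu, −zu)`, `W_u θ = (0, −zu e^{−iθ}; zu e^{iθ}, 0)` (the public twin of ★ (M2) `two_sin_smul_integral_chart_eq_integral_sqrtKernel`, which is the case `u = i`).
[cite: Varadarajan1989, §6.4 Lemma 21] -/
theorem two_sin_smul_integral_chart_eq_integral_sqrtKernel_of_dir (f : Matrix (Fin 2) (Fin 2) ℂ → E) (z u : ℂ)
    (hu : u = I ∨ u = -I) {ψ : ℝ} (hψ : 0 < Real.sin ψ) :
    (2 * Real.sin ψ) • ∫ p in Ioi (1 : ℝ) ×ˢ Ioc (0 : ℝ) (2 * π),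
        f ((z * cexp (-((ψ : ℂ) * u))) • (1 : Matrix (Fin 2) (Fin 2) ℂ) +
          (z * cexp ((ψ : ℂ) * u) - z * cexp (-((ψ : ℂ) * u))) •
            !![((p.1 : ℝ) : ℂ), -(Real.sqrt (p.1 * (p.1 - 1)) : ℂ) * cexp (-((p.2 : ℂ) * I));
               (Real.sqrt (p.1 * (p.1 - 1)) : ℂ) * cexp ((p.2 : ℂ) * I), 1 - ((p.1 : ℝ) : ℂ)]) =
      ∫ p in Ioi (0 : ℝ) ×ˢ Ioc (0 : ℝ) (2 * π),
        f (Matrix.diagonal ![z * cexp ((ψ : ℂ) * u), z * cexp (-((ψ : ℂ) * u))] +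
          p.1 • Matrix.diagonal ![z * u, -(z * u)] +
          Real.sqrt (p.1 * (p.1 + 2 * Real.sin ψ)) •
            !![(0 : ℂ), -(z * u) * cexp (-((p.2 : ℂ) * I)); (z * u) * cexp ((p.2 : ℂ) * I), 0]) := by
  -- adapted from ★ FILE M (private `two_sin_smul_integral_chart_eq_aux`)
  rw [smul_setIntegral_Ioi_one_eq' (Real.sin ψ) hψ]
  refine setIntegral_congr_fun (measurableSet_Ioi.prod measurableSet_Ioc) fun p _ => ?_
  dsimp only
  rw [smul_one_add_smul_chart_eq _ _ (z * u) hψ (mul_exp_sub_mul_exp' z u hu ψ) p.1 p.2]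

/-! ## §2 The one-sided values `g(0±)` -/

/-- The off-diagonal family `W θ = (0, −c e^{−iθ}; c e^{iθ}, 0)` is continuous in `θ`. [folklore] -/
private theorem continuous_offDiag' (c : ℂ) : Continuous fun θ : ℝ =>
    (!![(0 : ℂ), -c * cexp (-((θ : ℂ) * I)); c * cexp ((θ : ℂ) * I), 0] : Matrix (Fin 2) (Fin 2) ℂ) := by
  refine continuous_matrix fun i j => ?_
  fin_cases i <;> fin_cases j <;> simp <;> fun_prop

/-- The torus curve `A(ψ) = diag(z e^{ψu}, z e^{−ψu})` is continuous. [folklore] -/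
private theorem continuous_diagCurve (z u : ℂ) : Continuous fun ψ : ℝ =>
    (Matrix.diagonal ![z * cexp ((ψ : ℂ) * u), z * cexp (-((ψ : ℂ) * u))] : Matrix (Fin 2) (Fin 2) ℂ) := by
  have hd : Continuous fun ψ : ℝ => ![z * cexp ((ψ : ℂ) * u), z * cexp (-((ψ : ℂ) * u))] := by
    refine continuous_pi fun i => ?_
    fin_cases i
    · simpa using (by fun_prop : Continuous fun ψ : ℝ => z * cexp ((ψ : ℂ) * u))
    · simpa using (by fun_prop : Continuous fun ψ : ℝ => z * cexp (-((ψ : ℂ) * u)))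
  exact hd.matrix_diagonal

/-- At `ψ = 0` the torus curve is the central point `z·1`. [folklore] -/
private theorem diagCurve_zero' (z u : ℂ) :
    (Matrix.diagonal ![z * cexp ((((0 : ℝ) : ℂ)) * u), z * cexp (-((((0 : ℝ) : ℂ)) * u))] :
      Matrix (Fin 2) (Fin 2) ℂ) = z • (1 : Matrix (Fin 2) (Fin 2) ℂ) := by
  ext i j; fin_cases i <;> fin_cases j <;> simp

/-- The support-control functional `ℓ(y) = Re(c̄ y₀₀)∕|c|²`: `ℓ(diag(c,−c)) = 1`, `ℓ(W θ) = 0`. [folklore] -/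
private theorem exists_functional' (c : ℂ) (hc : c ≠ 0) :
    ∃ ℓ : Matrix (Fin 2) (Fin 2) ℂ →L[ℝ] ℝ,
      ℓ (Matrix.diagonal ![c, -c]) = 1 ∧
      ∀ θ : ℝ, ℓ !![(0 : ℂ), -c * cexp (-((θ : ℂ) * I)); c * cexp ((θ : ℂ) * I), 0] = 0 := by
  -- adapted from ★ FILE M (private `exists_functional`)
  refine ⟨LinearMap.toContinuousLinearMap
    { toFun := fun y => ((starRingEnd ℂ) c * y 0 0).re / Complex.normSq c
      map_add' := fun x y => by simp [mul_add, add_div]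
      map_smul' := fun r x => by
        simp [Matrix.smul_apply, Complex.real_smul, mul_left_comm _ (r : ℂ), mul_div_assoc] }, ?_, fun θ => ?_⟩
  · simp only [LinearMap.coe_toContinuousLinearMap', LinearMap.coe_mk, AddHom.coe_mk,
      Matrix.diagonal_apply_eq, Matrix.cons_val_zero]
    rw [← Complex.normSq_eq_conj_mul_self]
    simp [hc]
  · simp

/-- One-sided master, direction `u ∈ {i, −i}`: as `ψ → 0⁺` the normalised chart integral `g_u` tends to the half-cone integral
`∫_{τ>0, θ∈(0,2π]} f(z·1 + τ•diag(zu, −zu) + τ•W_u θ)` ((M2)_u on `0 < ψ < 1`, then ★ (K0) `tendsto_integral_sqrtKernel`). [cite: Varadarajan1989, §6.4 Lemma 21 (c)] -/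
private theorem tendsto_nhdsGT_aux (f : Matrix (Fin 2) (Fin 2) ℂ → E) (hf : Continuous f) (hfc : HasCompactSupport f)
    (z u : ℂ) (hz : z ≠ 0) (hu : u = I ∨ u = -I) :
    Tendsto (fun ψ : ℝ => (2 * Real.sin ψ) •
        ∫ p in Ioi (1 : ℝ) ×ˢ Ioc (0 : ℝ) (2 * π),
          f ((z * cexp (-((ψ : ℂ) * u))) • (1 : Matrix (Fin 2) (Fin 2) ℂ) +
            (z * cexp ((ψ : ℂ) * u) - z * cexp (-((ψ : ℂ) * u))) •
              !![((p.1 : ℝ) : ℂ), -(Real.sqrt (p.1 * (p.1 - 1)) : ℂ) * cexp (-((p.2 : ℂ) * I));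
                 (Real.sqrt (p.1 * (p.1 - 1)) : ℂ) * cexp ((p.2 : ℂ) * I), 1 - ((p.1 : ℝ) : ℂ)]))
      (𝓝[>] 0)
      (𝓝 (∫ p in Ioi (0 : ℝ) ×ˢ Ioc (0 : ℝ) (2 * π),
        f (z • (1 : Matrix (Fin 2) (Fin 2) ℂ) + p.1 • Matrix.diagonal ![z * u, -(z * u)] +
          p.1 • !![(0 : ℂ), -(z * u) * cexp (-((p.2 : ℂ) * I)); (z * u) * cexp ((p.2 : ℂ) * I), 0]))) := by
  -- the model data
  obtain ⟨A, hA⟩ : ∃ A : ℝ → Matrix (Fin 2) (Fin 2) ℂ,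
      A = fun ψ : ℝ => Matrix.diagonal ![z * cexp ((ψ : ℂ) * u), z * cexp (-((ψ : ℂ) * u))] := ⟨_, rfl⟩
  obtain ⟨V, hV⟩ : ∃ V : Matrix (Fin 2) (Fin 2) ℂ, V = Matrix.diagonal ![z * u, -(z * u)] := ⟨_, rfl⟩
  obtain ⟨W, hW⟩ : ∃ W : ℝ → Matrix (Fin 2) (Fin 2) ℂ,
      W = fun θ : ℝ => !![(0 : ℂ), -(z * u) * cexp (-((θ : ℂ) * I)); (z * u) * cexp ((θ : ℂ) * I), 0] := ⟨_, rfl⟩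
  have hzu : z * u ≠ 0 := mul_ne_zero hz (by rcases hu with rfl | rfl <;> simp [Complex.I_ne_zero])
  obtain ⟨ℓ, hℓV, hℓW⟩ := exists_functional' (z * u) hzu
  rw [← hV] at hℓV
  have hℓW' : ∀ θ, ℓ (W θ) = 0 := fun θ => by rw [hW]; exact hℓW θ
  have hAc : Continuous A := by rw [hA]; exact continuous_diagCurve z u
  have hWc : Continuous W := by rw [hW]; exact continuous_offDiag' (z * u)
  -- (K0): the kernel integral is continuous at `ψ = 0`
  have hK0 := tendsto_integral_sqrtKernel f hf hfc A hAc V W hWc ℓ hℓV hℓW'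
  have hA0 : A 0 = z • (1 : Matrix (Fin 2) (Fin 2) ℂ) := by rw [hA]; exact diagCurve_zero' z u
  rw [hA0] at hK0
  -- (M2)_u: on `0 < ψ < 1` the chart integral IS the kernel integral
  have hsin : ∀ ψ ∈ Ioo (0 : ℝ) 1, 0 < Real.sin ψ := fun ψ hψ =>
    Real.sin_pos_of_pos_of_lt_pi hψ.1 (hψ.2.trans_le (by linarith [Real.pi_gt_three]))
  have hev : (fun ψ : ℝ => (2 * Real.sin ψ) •
        ∫ p in Ioi (1 : ℝ) ×ˢ Ioc (0 : ℝ) (2 * π),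
          f ((z * cexp (-((ψ : ℂ) * u))) • (1 : Matrix (Fin 2) (Fin 2) ℂ) +
            (z * cexp ((ψ : ℂ) * u) - z * cexp (-((ψ : ℂ) * u))) •
              !![((p.1 : ℝ) : ℂ), -(Real.sqrt (p.1 * (p.1 - 1)) : ℂ) * cexp (-((p.2 : ℂ) * I));
                 (Real.sqrt (p.1 * (p.1 - 1)) : ℂ) * cexp ((p.2 : ℂ) * I), 1 - ((p.1 : ℝ) : ℂ)])) =ᶠ[𝓝[>] 0]
      fun ψ => ∫ p in Ioi (0 : ℝ) ×ˢ Ioc (0 : ℝ) (2 * π),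
        f (A ψ + p.1 • V + Real.sqrt (p.1 * (p.1 + 2 * Real.sin ψ)) • W p.2) := by
    filter_upwards [Ioo_mem_nhdsGT (zero_lt_one' ℝ)] with ψ hψ
    rw [hA, hV, hW]
    exact two_sin_smul_integral_chart_eq_integral_sqrtKernel_of_dir f z u hu (hsin ψ hψ)
  have hlim := (hK0.mono_left nhdsWithin_le_nhds).congr' hev.symm
  rw [hV, hW] at hlim
  exact hlim

/-- **`g(0+)` — THE RIGHT VALUE AT THE CENTRAL WALL.**  For `f` continuous with compact support on `M₂(ℂ)` and `z ≠ 0`, the normalised chart integral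
`g(ψ) = 2 sin ψ · ∫_{s>1, θ∈(0,2π]} f(Y(ψ,s,θ))`, `Y(ψ,s,θ) = z e^{−iψ}·1 + (z e^{iψ} − z e^{−iψ})·P(s,θ)` (★ FILE M's `g`: `2 sin ψ` times the integral of `f` over the hyperboloid
chart of the class of `γ_ψ = diag(z e^{iψ}, z e^{−iψ})`) tends, as `ψ → 0⁺`, to the HALF-CONE INTEGRAL `∫_{τ>0, θ∈(0,2π]} f(z·1 + τ·diag(iz, −iz) + τ·(0, −iz e^{−iθ}; iz e^{iθ}, 0)) dτ dθ`
— the integral of `f` over `z·1 + ` the nilpotent half-cone `{τ·iz·(1, −e^{−iθ}; e^{iθ}, −1)}` (Varadarajan's `U(0+) = ½∫u(s,0)ds`).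
[cite: Varadarajan1989, §6.4 Lemma 21 (c), Thm 23] [cite: Rogawski1990, §8.2 p. 119] -/
theorem tendsto_two_sin_smul_integral_chart_nhdsGT (f : Matrix (Fin 2) (Fin 2) ℂ → E) (hf : Continuous f) (hfc : HasCompactSupport f)
    (z : ℂ) (hz : z ≠ 0) :
    Tendsto (fun ψ : ℝ => (2 * Real.sin ψ) •
        ∫ p in Ioi (1 : ℝ) ×ˢ Ioc (0 : ℝ) (2 * π),
          f ((z * cexp (-((ψ : ℂ) * I))) • (1 : Matrix (Fin 2) (Fin 2) ℂ) +
            (z * cexp ((ψ : ℂ) * I) - z * cexp (-((ψ : ℂ) * I))) •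
              !![((p.1 : ℝ) : ℂ), -(Real.sqrt (p.1 * (p.1 - 1)) : ℂ) * cexp (-((p.2 : ℂ) * I));
                 (Real.sqrt (p.1 * (p.1 - 1)) : ℂ) * cexp ((p.2 : ℂ) * I), 1 - ((p.1 : ℝ) : ℂ)]))
      (𝓝[>] 0)
      (𝓝 (∫ p in Ioi (0 : ℝ) ×ˢ Ioc (0 : ℝ) (2 * π),
        f (z • (1 : Matrix (Fin 2) (Fin 2) ℂ) + p.1 • Matrix.diagonal ![z * I, -(z * I)] +
          p.1 • !![(0 : ℂ), -(z * I) * cexp (-((p.2 : ℂ) * I)); (z * I) * cexp ((p.2 : ℂ) * I), 0]))) :=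
  tendsto_nhdsGT_aux f hf hfc z I hz (Or.inl rfl)

/-- **`g(0−)` — THE LEFT VALUE AT THE CENTRAL WALL.**  Same `g`; as `ψ → 0⁻` it tends to MINUS the integral of `f` over the OTHER half-cone:
`−∫_{τ>0, θ∈(0,2π]} f(z·1 + τ·diag(−iz, iz) + τ·(0, iz e^{−iθ}; −iz e^{iθ}, 0)) dτ dθ` (the reflection ★ (M3): `g(ψ) = −g_{−i}(−ψ)`, and `g_{−i}(0+)` is the `u = −i` half-cone
integral; Varadarajan's `U(0−) = −½∫u(−s,0)ds`). [cite: Varadarajan1989, §6.4 Lemma 21 (c), Thm 23] [cite: Rogawski1990, §8.2 p. 119] -/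
theorem tendsto_two_sin_smul_integral_chart_nhdsLT (f : Matrix (Fin 2) (Fin 2) ℂ → E) (hf : Continuous f) (hfc : HasCompactSupport f)
    (z : ℂ) (hz : z ≠ 0) :
    Tendsto (fun ψ : ℝ => (2 * Real.sin ψ) •
        ∫ p in Ioi (1 : ℝ) ×ˢ Ioc (0 : ℝ) (2 * π),
          f ((z * cexp (-((ψ : ℂ) * I))) • (1 : Matrix (Fin 2) (Fin 2) ℂ) +
            (z * cexp ((ψ : ℂ) * I) - z * cexp (-((ψ : ℂ) * I))) •
              !![((p.1 : ℝ) : ℂ), -(Real.sqrt (p.1 * (p.1 - 1)) : ℂ) * cexp (-((p.2 : ℂ) * I));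
                 (Real.sqrt (p.1 * (p.1 - 1)) : ℂ) * cexp ((p.2 : ℂ) * I), 1 - ((p.1 : ℝ) : ℂ)]))
      (𝓝[<] 0)
      (𝓝 (-(∫ p in Ioi (0 : ℝ) ×ˢ Ioc (0 : ℝ) (2 * π),
        f (z • (1 : Matrix (Fin 2) (Fin 2) ℂ) + p.1 • Matrix.diagonal ![-(z * I), z * I] +
          p.1 • !![(0 : ℂ), (z * I) * cexp (-((p.2 : ℂ) * I)); -(z * I) * cexp ((p.2 : ℂ) * I), 0])))) := by
  -- the `u = −i` right limit, composed with `ψ ↦ −ψ : 𝓝[<] 0 → 𝓝[>] 0`, negated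
  have hG := tendsto_nhdsGT_aux f hf hfc z (-I) hz (Or.inr rfl)
  have hneg : Tendsto (fun ψ : ℝ => -ψ) (𝓝[<] (0 : ℝ)) (𝓝[>] 0) := by
    simpa using tendsto_neg_nhdsLT (a := (0 : ℝ))
  have hL := (hG.comp hneg).neg
  have hval : -(∫ p in Ioi (0 : ℝ) ×ˢ Ioc (0 : ℝ) (2 * π),
        f (z • (1 : Matrix (Fin 2) (Fin 2) ℂ) + p.1 • Matrix.diagonal ![z * -I, -(z * -I)] +
          p.1 • !![(0 : ℂ), -(z * -I) * cexp (-((p.2 : ℂ) * I)); (z * -I) * cexp ((p.2 : ℂ) * I), 0])) =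
      -(∫ p in Ioi (0 : ℝ) ×ˢ Ioc (0 : ℝ) (2 * π),
        f (z • (1 : Matrix (Fin 2) (Fin 2) ℂ) + p.1 • Matrix.diagonal ![-(z * I), z * I] +
          p.1 • !![(0 : ℂ), (z * I) * cexp (-((p.2 : ℂ) * I)); -(z * I) * cexp ((p.2 : ℂ) * I), 0])) := by
    simp only [mul_neg, neg_neg]
  rw [hval] at hL
  refine hL.congr fun ψ => ?_
  simp only [Function.comp_apply, Real.sin_neg, Complex.ofReal_neg, mul_neg, neg_mul, neg_neg, neg_smul]

/-! ## §3 The order-`0` jump in the ★ `HasOneSidedJump` currency (`E = ℂ`) -/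

open Literature.NumberTheory.Automorphic.Shelstad1979.StableOrbitalIntegrals in
/-- **THE ORDER-0 JUMP AT THE CENTRAL WALL (chart level)**: for `f : M₂(ℂ) → ℂ` continuous with compact support and `z ≠ 0`, `ψ ↦ 2 sin ψ · ∫_{s>1,θ} f(Y(ψ,s,θ))` has both
one-sided limits at `0` and JUMPS by the integral of `f` over the full nilpotent cone at `z·1`,
`∫_{τ>0,θ} f(z·1 + τ·N(θ)) dτdθ + ∫_{τ>0,θ} f(z·1 − τ·N(θ)) dτdθ`, `N(θ) = diag(iz,−iz) + (0, −iz e^{−iθ}; iz e^{iθ}, 0)` (★ carpet `HasOneSidedJump`; Shelstad's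
`lim_{ν↓0} − lim_{ν↑0}`, Varadarajan Thm 23 ∕ Rao's cone integral). [cite: Shelstad1979, Lemma 4.3 p. 25] [cite: Varadarajan1989, §6.4 Thm 23] -/
theorem hasOneSidedJump_two_sin_mul_integral_chart (f : Matrix (Fin 2) (Fin 2) ℂ → ℂ) (hf : Continuous f) (hfc : HasCompactSupport f)
    (z : ℂ) (hz : z ≠ 0) :
    HasOneSidedJump (fun ψ : ℝ => (2 * Real.sin ψ : ℂ) *
        ∫ p in Ioi (1 : ℝ) ×ˢ Ioc (0 : ℝ) (2 * π),
          f ((z * cexp (-((ψ : ℂ) * I))) • (1 : Matrix (Fin 2) (Fin 2) ℂ) +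
            (z * cexp ((ψ : ℂ) * I) - z * cexp (-((ψ : ℂ) * I))) •
              !![((p.1 : ℝ) : ℂ), -(Real.sqrt (p.1 * (p.1 - 1)) : ℂ) * cexp (-((p.2 : ℂ) * I));
                 (Real.sqrt (p.1 * (p.1 - 1)) : ℂ) * cexp ((p.2 : ℂ) * I), 1 - ((p.1 : ℝ) : ℂ)]))
      ((∫ p in Ioi (0 : ℝ) ×ˢ Ioc (0 : ℝ) (2 * π),
        f (z • (1 : Matrix (Fin 2) (Fin 2) ℂ) + p.1 • Matrix.diagonal ![z * I, -(z * I)] +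
          p.1 • !![(0 : ℂ), -(z * I) * cexp (-((p.2 : ℂ) * I)); (z * I) * cexp ((p.2 : ℂ) * I), 0])) +
       ∫ p in Ioi (0 : ℝ) ×ˢ Ioc (0 : ℝ) (2 * π),
        f (z • (1 : Matrix (Fin 2) (Fin 2) ℂ) + p.1 • Matrix.diagonal ![-(z * I), z * I] +
          p.1 • !![(0 : ℂ), (z * I) * cexp (-((p.2 : ℂ) * I)); -(z * I) * cexp ((p.2 : ℂ) * I), 0])) := by
  have hp := tendsto_two_sin_smul_integral_chart_nhdsGT f hf hfc z hz
  have hm := tendsto_two_sin_smul_integral_chart_nhdsLT f hf hfc z hz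
  have hsmul : ∀ (ψ : ℝ) (x : ℂ), (2 * Real.sin ψ) • x = (2 * Real.sin ψ : ℂ) * x := fun ψ x => by
    rw [Complex.real_smul]; push_cast; ring
  refine ⟨_, _, ?_, ?_, by rw [sub_neg_eq_add]⟩
  · exact hp.congr fun ψ => hsmul ψ _
  · exact hm.congr fun ψ => hsmul ψ _

end Literature.NumberTheory.Automorphic

/-! ## §4 On the GROUP `U(1,1)`: the one-sided values of `2 sin ψ · ∫_{U(1,1)} f(h·γ_ψ·h⁻¹) dμ` through the orbit-chart identity ★ (HB) -/

namespace Literature.NumberTheory.Automorphic.UnitaryGroup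

open _root_.MeasureTheory Set Filter _root_.Topology _root_.Complex
open scoped Real Matrix.Norms.Operator MatrixGroups

variable {E : Type*} [NormedAddCommGroup E] [NormedSpace ℝ E]

/-- **Core step (standard chart), order 0.**  Let `S ≤ GL₂(ℂ)` contain the circle torus, `μ` a measure on `S`, and suppose the ORBIT-CHART IDENTITY with constant `C₁`
(`∫_S f(h·diag(a,b)·h⁻¹) dμ = C₁ • ∫_{s>1,θ∈(0,2π]} f(b•1 + (a−b)•P(s,θ))` for continuous compactly supported `f` and `a ≠ b` on the circle; ★ (HB) for `S = U(1,1)`).  Then for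
`f` continuous with compact support and `z ∈ S¹`, `ψ ↦ 2 sin ψ · ∫_S f(h·diag(z e^{iψ}, z e^{−iψ})·h⁻¹) dμ` tends to `C₁ • g(0+)` as `ψ → 0⁺` and to `C₁ • g(0−)` as `ψ → 0⁻`
(★ §2 values). [cite: Varadarajan1989, §6.4 Lemma 21 (c), Thm 23] [cite: Rogawski1990, §8.2 p. 119] -/
theorem tendsto_two_sin_smul_orbitalIntegral_nhdsGT_nhdsLT_of_chart_identity (S : Subgroup (GL (Fin 2) ℂ))
    [MeasurableSpace S] (μ : Measure S) (hS : ∀ w : Fin 2 → Circle, circleDiagonal 2 w ∈ S) (C₁ : ℝ)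
    (hμ : ∀ (f : Matrix (Fin 2) (Fin 2) ℂ → E), Continuous f → HasCompactSupport f → ∀ a b : Circle, a ≠ b →
      ∫ h : S, f (((h : GL (Fin 2) ℂ) : Matrix (Fin 2) (Fin 2) ℂ) * Matrix.diagonal ![(a : ℂ), (b : ℂ)] *
          (((h⁻¹ : S) : GL (Fin 2) ℂ) : Matrix (Fin 2) (Fin 2) ℂ)) ∂μ =
        C₁ • ∫ p in Ioi (1 : ℝ) ×ˢ Ioc (0 : ℝ) (2 * π), f (((b : ℂ)) • (1 : Matrix (Fin 2) (Fin 2) ℂ) +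
          (((a : ℂ)) - (b : ℂ)) • !![(p.1 : ℂ), -(Real.sqrt (p.1 * (p.1 - 1)) : ℂ) * cexp (-(p.2 * I));
            (Real.sqrt (p.1 * (p.1 - 1)) : ℂ) * cexp (p.2 * I), 1 - p.1]))
    (f : Matrix (Fin 2) (Fin 2) ℂ → E) (hf : Continuous f) (hfc : HasCompactSupport f) (z : Circle) :
    Tendsto (fun ψ : ℝ => (2 * Real.sin ψ) •
        ∫ h : S, f (((h * ⟨circleDiagonal 2 ![z * Circle.exp ψ, z * Circle.exp (-ψ)], hS _⟩ * h⁻¹ : S) :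
          GL (Fin 2) ℂ) : Matrix (Fin 2) (Fin 2) ℂ) ∂μ)
      (𝓝[>] 0)
      (𝓝 (C₁ • ∫ p in Ioi (0 : ℝ) ×ˢ Ioc (0 : ℝ) (2 * π),
        f ((z : ℂ) • (1 : Matrix (Fin 2) (Fin 2) ℂ) + p.1 • Matrix.diagonal ![(z : ℂ) * I, -((z : ℂ) * I)] +
          p.1 • !![(0 : ℂ), -((z : ℂ) * I) * cexp (-((p.2 : ℂ) * I)); ((z : ℂ) * I) * cexp ((p.2 : ℂ) * I), 0]))) ∧
    Tendsto (fun ψ : ℝ => (2 * Real.sin ψ) •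
        ∫ h : S, f (((h * ⟨circleDiagonal 2 ![z * Circle.exp ψ, z * Circle.exp (-ψ)], hS _⟩ * h⁻¹ : S) :
          GL (Fin 2) ℂ) : Matrix (Fin 2) (Fin 2) ℂ) ∂μ)
      (𝓝[<] 0)
      (𝓝 (C₁ • -(∫ p in Ioi (0 : ℝ) ×ˢ Ioc (0 : ℝ) (2 * π),
        f ((z : ℂ) • (1 : Matrix (Fin 2) (Fin 2) ℂ) + p.1 • Matrix.diagonal ![-((z : ℂ) * I), (z : ℂ) * I] +
          p.1 • !![(0 : ℂ), ((z : ℂ) * I) * cexp (-((p.2 : ℂ) * I)); -((z : ℂ) * I) * cexp ((p.2 : ℂ) * I), 0])))) := by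
  -- adapted from ★ (R1G) `tendsto_deriv_two_sin_smul_integral_conj_of_chart_identity` (the key identity `F = C₁ • g` on `|ψ| < 1`)
  obtain ⟨g, hg⟩ : ∃ g : ℝ → E, g = fun ψ : ℝ => (2 * Real.sin ψ) •
        ∫ p in Ioi (1 : ℝ) ×ˢ Ioc (0 : ℝ) (2 * π),
          f (((z : ℂ) * cexp (-((ψ : ℂ) * I))) • (1 : Matrix (Fin 2) (Fin 2) ℂ) +
            ((z : ℂ) * cexp ((ψ : ℂ) * I) - (z : ℂ) * cexp (-((ψ : ℂ) * I))) •
              !![((p.1 : ℝ) : ℂ), -(Real.sqrt (p.1 * (p.1 - 1)) : ℂ) * cexp (-((p.2 : ℂ) * I));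
                 (Real.sqrt (p.1 * (p.1 - 1)) : ℂ) * cexp ((p.2 : ℂ) * I), 1 - ((p.1 : ℝ) : ℂ)]) := ⟨_, rfl⟩
  obtain ⟨F, hF⟩ : ∃ F : ℝ → E, F = fun ψ : ℝ => (2 * Real.sin ψ) •
        ∫ h : S, f (((h * ⟨circleDiagonal 2 ![z * Circle.exp ψ, z * Circle.exp (-ψ)], hS _⟩ * h⁻¹ : S) :
          GL (Fin 2) ℂ) : Matrix (Fin 2) (Fin 2) ℂ) ∂μ := ⟨_, rfl⟩
  rw [← hF]
  have hGT := tendsto_two_sin_smul_integral_chart_nhdsGT f hf hfc (z : ℂ) z.coe_ne_zero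
  have hLT := tendsto_two_sin_smul_integral_chart_nhdsLT f hf hfc (z : ℂ) z.coe_ne_zero
  rw [← hg] at hGT hLT
  -- the key identity `F ψ = C₁ • g ψ` on `|ψ| < 1`
  have key : ∀ ψ ∈ Ioo (-1 : ℝ) 1, F ψ = C₁ • g ψ := by
    intro ψ hψ
    rcases eq_or_ne ψ 0 with rfl | hψ0
    · rw [hF, hg]; simp
    have hab : z * Circle.exp ψ ≠ z * Circle.exp (-ψ) := by
      intro h
      have h' := mul_left_cancel h
      rw [Circle.exp_eq_exp] at h'
      obtain ⟨m, hm⟩ := h'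
      have hm' : (m : ℝ) * π = ψ := by linarith
      have habs : |(m : ℝ)| * π < 1 := by
        rw [← abs_of_pos Real.pi_pos, ← abs_mul, hm']; exact abs_lt.2 ⟨hψ.1, hψ.2⟩
      have hm0 : m = 0 := by
        by_contra hne
        have h1 : (1 : ℝ) ≤ |(m : ℝ)| := by exact_mod_cast Int.one_le_abs hne
        nlinarith [Real.pi_gt_three, abs_nonneg (m : ℝ)]
      subst hm0
      simp at hm'
      exact hψ0 hm'.symm
    have h1 := hμ f hf hfc _ _ hab
    have h2 : ∀ h : S, (((h * ⟨circleDiagonal 2 ![z * Circle.exp ψ, z * Circle.exp (-ψ)], hS _⟩ * h⁻¹ : S) :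
          GL (Fin 2) ℂ) : Matrix (Fin 2) (Fin 2) ℂ) =
        ((h : GL (Fin 2) ℂ) : Matrix (Fin 2) (Fin 2) ℂ) *
          Matrix.diagonal ![((z * Circle.exp ψ : Circle) : ℂ), ((z * Circle.exp (-ψ) : Circle) : ℂ)] *
          (((h⁻¹ : S) : GL (Fin 2) ℂ) : Matrix (Fin 2) (Fin 2) ℂ) := fun h => by
      simp only [Subgroup.coe_mul, Units.val_mul, coe_circleDiagonal]
      congr 2
      funext i; fin_cases i <;> rfl
    have h3 : ((z * Circle.exp ψ : Circle) : ℂ) = (z : ℂ) * cexp ((ψ : ℂ) * I) := by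
      rw [Circle.coe_mul, Circle.coe_exp]
    have h4 : ((z * Circle.exp (-ψ) : Circle) : ℂ) = (z : ℂ) * cexp (-((ψ : ℂ) * I)) := by
      rw [Circle.coe_mul, Circle.coe_exp]; push_cast; rw [neg_mul]
    rw [hF, hg]; dsimp only; simp_rw [h2]; rw [h1, smul_comm, h3, h4]
  have hev : F =ᶠ[𝓝 (0 : ℝ)] fun ψ => C₁ • g ψ := by
    filter_upwards [isOpen_Ioo.mem_nhds (show (0 : ℝ) ∈ Ioo (-1 : ℝ) 1 from ⟨by norm_num, by norm_num⟩)] with ψ hψ using key ψ hψ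
  refine ⟨?_, ?_⟩
  · exact (hGT.const_smul C₁).congr' (hev.filter_mono nhdsWithin_le_nhds).symm
  · exact (hLT.const_smul C₁).congr' (hev.filter_mono nhdsWithin_le_nhds).symm

/-- **THE ONE-SIDED VALUES ON THE GROUP `U(1,1) = U(diag(1,−1))` — HYPOTHESIS-FREE.**  For every Haar measure `μ` there is ONE `C₁ > 0` (★ (HB)
`exists_integral_comp_conj_diag_eq_smul_integral_chart`) such that for every continuous compactly supported `f : M₂(ℂ) → E` and every `z ∈ S¹` the Weyl-normalised orbital integral
`ψ ↦ 2 sin ψ · ∫_{U(1,1)} f(h·diag(z e^{iψ}, z e^{−iψ})·h⁻¹) dμ(h)` tends to `C₁ •` (the `u = i` half-cone integral of `f` at `z·1`) as `ψ → 0⁺` and to `−C₁ •` (the `u = −i` half-cone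
integral) as `ψ → 0⁻`.  (The VALUES behind the EXISTENCE statement ★ (J0-H2) `archTorusOrbitalOneSidedLimitsTwo_holds`, on the standard form.)
[cite: Varadarajan1989, §6.4 Lemma 21 (c), Thm 23] [cite: Rogawski1990, §8.2 p. 119] -/
theorem exists_tendsto_two_sin_smul_orbitalIntegral_nhdsGT_nhdsLT
    [MeasurableSpace ↥(unitaryGroupOfForm (starRingEnd ℂ) (Matrix.diagonal ![(1 : ℂ), -1]))]
    [BorelSpace ↥(unitaryGroupOfForm (starRingEnd ℂ) (Matrix.diagonal ![(1 : ℂ), -1]))]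
    (μ : Measure ↥(unitaryGroupOfForm (starRingEnd ℂ) (Matrix.diagonal ![(1 : ℂ), -1]))) [μ.IsHaarMeasure] :
    ∃ C₁ : ℝ, 0 < C₁ ∧
      ∀ (f : Matrix (Fin 2) (Fin 2) ℂ → E), Continuous f → HasCompactSupport f → ∀ z : Circle,
        Tendsto (fun ψ : ℝ => (2 * Real.sin ψ) •
            ∫ h : ↥(unitaryGroupOfForm (starRingEnd ℂ) (Matrix.diagonal ![(1 : ℂ), -1])),
              f (((h * ⟨circleDiagonal 2 ![z * Circle.exp ψ, z * Circle.exp (-ψ)], circleDiagonal_mem_unitaryGroupOfForm_diagonal 2 _ _⟩ * h⁻¹ :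
                ↥(unitaryGroupOfForm (starRingEnd ℂ) (Matrix.diagonal ![(1 : ℂ), -1]))) : GL (Fin 2) ℂ) : Matrix (Fin 2) (Fin 2) ℂ) ∂μ)
          (𝓝[>] 0)
          (𝓝 (C₁ • ∫ p in Ioi (0 : ℝ) ×ˢ Ioc (0 : ℝ) (2 * π),
            f ((z : ℂ) • (1 : Matrix (Fin 2) (Fin 2) ℂ) + p.1 • Matrix.diagonal ![(z : ℂ) * I, -((z : ℂ) * I)] +
              p.1 • !![(0 : ℂ), -((z : ℂ) * I) * cexp (-((p.2 : ℂ) * I)); ((z : ℂ) * I) * cexp ((p.2 : ℂ) * I), 0]))) ∧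
        Tendsto (fun ψ : ℝ => (2 * Real.sin ψ) •
            ∫ h : ↥(unitaryGroupOfForm (starRingEnd ℂ) (Matrix.diagonal ![(1 : ℂ), -1])),
              f (((h * ⟨circleDiagonal 2 ![z * Circle.exp ψ, z * Circle.exp (-ψ)], circleDiagonal_mem_unitaryGroupOfForm_diagonal 2 _ _⟩ * h⁻¹ :
                ↥(unitaryGroupOfForm (starRingEnd ℂ) (Matrix.diagonal ![(1 : ℂ), -1]))) : GL (Fin 2) ℂ) : Matrix (Fin 2) (Fin 2) ℂ) ∂μ)
          (𝓝[<] 0)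
          (𝓝 (C₁ • -(∫ p in Ioi (0 : ℝ) ×ˢ Ioc (0 : ℝ) (2 * π),
            f ((z : ℂ) • (1 : Matrix (Fin 2) (Fin 2) ℂ) + p.1 • Matrix.diagonal ![-((z : ℂ) * I), (z : ℂ) * I] +
              p.1 • !![(0 : ℂ), ((z : ℂ) * I) * cexp (-((p.2 : ℂ) * I)); -((z : ℂ) * I) * cexp ((p.2 : ℂ) * I), 0])))) := by
  obtain ⟨C₁, hC₁, h⟩ := exists_integral_comp_conj_diag_eq_smul_integral_chart (E := E) μ
  refine ⟨C₁, hC₁, fun f hf hfc z => ?_⟩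
  exact tendsto_two_sin_smul_orbitalIntegral_nhdsGT_nhdsLT_of_chart_identity _ μ
    (fun w => circleDiagonal_mem_unitaryGroupOfForm_diagonal 2 w _) C₁ (fun f hf _ a b _ => h f hf a b) f hf hfc z

open Literature.NumberTheory.Automorphic.Shelstad1979.StableOrbitalIntegrals in
/-- **THE ORDER-0 JUMP ON THE GROUP `U(1,1)`** (`E = ℂ`, ★ `HasOneSidedJump` currency): for every Haar `μ` ONE `C₁ > 0` such that for every continuous compactly supported
`f : M₂(ℂ) → ℂ` and `z ∈ S¹`, `ψ ↦ 2 sin ψ · ∫_{U(1,1)} f(h·diag(z e^{iψ}, z e^{−iψ})·h⁻¹) dμ` has both one-sided limits at `ψ = 0` and jumps by `C₁ ·` (the integral of `f` over the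
nilpotent cone at `z·1`, both halves).  The `U(1,1)_w`-block input of the (I₃) order-0 clause of organ (J-H). [cite: Shelstad1979, Lemma 4.3 p. 25] [cite: Varadarajan1989, §6.4 Thm 23]
[cite: Rogawski1990, §8.2 p. 119] -/
theorem exists_hasOneSidedJump_two_sin_mul_orbitalIntegral
    [MeasurableSpace ↥(unitaryGroupOfForm (starRingEnd ℂ) (Matrix.diagonal ![(1 : ℂ), -1]))]
    [BorelSpace ↥(unitaryGroupOfForm (starRingEnd ℂ) (Matrix.diagonal ![(1 : ℂ), -1]))]
    (μ : Measure ↥(unitaryGroupOfForm (starRingEnd ℂ) (Matrix.diagonal ![(1 : ℂ), -1]))) [μ.IsHaarMeasure] :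
    ∃ C₁ : ℝ, 0 < C₁ ∧
      ∀ (f : Matrix (Fin 2) (Fin 2) ℂ → ℂ), Continuous f → HasCompactSupport f → ∀ z : Circle,
        HasOneSidedJump (fun ψ : ℝ => (2 * Real.sin ψ : ℂ) *
            ∫ h : ↥(unitaryGroupOfForm (starRingEnd ℂ) (Matrix.diagonal ![(1 : ℂ), -1])),
              f (((h * ⟨circleDiagonal 2 ![z * Circle.exp ψ, z * Circle.exp (-ψ)], circleDiagonal_mem_unitaryGroupOfForm_diagonal 2 _ _⟩ * h⁻¹ :
                ↥(unitaryGroupOfForm (starRingEnd ℂ) (Matrix.diagonal ![(1 : ℂ), -1]))) : GL (Fin 2) ℂ) : Matrix (Fin 2) (Fin 2) ℂ) ∂μ)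
          ((C₁ : ℂ) * ((∫ p in Ioi (0 : ℝ) ×ˢ Ioc (0 : ℝ) (2 * π),
              f ((z : ℂ) • (1 : Matrix (Fin 2) (Fin 2) ℂ) + p.1 • Matrix.diagonal ![(z : ℂ) * I, -((z : ℂ) * I)] +
                p.1 • !![(0 : ℂ), -((z : ℂ) * I) * cexp (-((p.2 : ℂ) * I)); ((z : ℂ) * I) * cexp ((p.2 : ℂ) * I), 0])) +
            ∫ p in Ioi (0 : ℝ) ×ˢ Ioc (0 : ℝ) (2 * π),
              f ((z : ℂ) • (1 : Matrix (Fin 2) (Fin 2) ℂ) + p.1 • Matrix.diagonal ![-((z : ℂ) * I), (z : ℂ) * I] +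
                p.1 • !![(0 : ℂ), ((z : ℂ) * I) * cexp (-((p.2 : ℂ) * I)); -((z : ℂ) * I) * cexp ((p.2 : ℂ) * I), 0]))) := by
  obtain ⟨C₁, hC₁, h⟩ := exists_tendsto_two_sin_smul_orbitalIntegral_nhdsGT_nhdsLT (E := ℂ) μ
  refine ⟨C₁, hC₁, fun f hf hfc z => ?_⟩
  obtain ⟨hp, hm⟩ := h f hf hfc z
  have hsmul : ∀ (ψ : ℝ) (x : ℂ), (2 * Real.sin ψ) • x = (2 * Real.sin ψ : ℂ) * x := fun ψ x => by
    rw [Complex.real_smul]; push_cast; ring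
  refine ⟨_, _, hp.congr fun ψ => hsmul ψ _, hm.congr fun ψ => hsmul ψ _, ?_⟩
  rw [Complex.real_smul, Complex.real_smul]
  ring

end Literature.NumberTheory.Automorphic.UnitaryGroup

end
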